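import Mathlib
import HarnessLib
import Summits.HubbardSuperconductivity.HubbardSuperconductivity.Theorems.KLProgrammeKLRegimeEngineAngularMass
import Summits.HubbardSuperconductivity.HubbardSuperconductivity.Theorems.KLProgrammeKLRegimeEnginePairLadderTowerShaped
import Summits.HubbardSuperconductivity.HubbardSuperconductivity.Theorems.KLProgrammeKLRegimeEngineV8DefsG5

/-!
# Route `KLProgramme` — crux K3, ENGINE child (gen 5 stmt-HubbardSuperconductivity-19918 `KLRegimeEngineV14`; gen-6 package `klEngGeo5`),
# stub `stub_engine_step_values`, (E2) at `1 ≤ n`: the Geo5 twins of the crossed-channel gain lemmas — `klam_phGain5_angular_le`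

Cell gate-hubbard-kl, seat hubbard-kl-k3c1-p1 (g6), technique «composed-map remainder propagation».  The gen-6 engine package is
`klEngGeo5 := klEngGeo4.scaleGains (2 ^ 28)` (`…EngineV8DefsG5`, p504396; `klEngGeo5.phGain n ρ = 2^28 · klEngGeo4.phGain n ρ`,
`klEngGeo4.phGain = klEngGeo3.phGain`).  The two Geo3-keyed gain lemmas of the composed-map bridge transfer by one multiplication:

* `klEngGeo5_phGain_eq_mul_geo3` — `klEngGeo5.phGain n ρ = 2^28 · klEngGeo3.phGain n ρ`;
* `klEngGeo5_phGain_pred_le` — `phGain (n − 1) ρ ≤ 4 · phGain n ρ` at Geo5 (from `klEngGeo3_phGain_pred_le`, p495632);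
* `klam_phGain5_angular_le` — the ANGULAR MASS number at Geo5:
  `Σ_p ρ_p·klEngGeo5.phGain n |p − c₀|_𝕋 ≤ 2^28·(2^24·klE0·4^{−n}·A(1+4n) + Z·4^{−n} + 2^24√klE0·2^{−n}·Z)` (from `klam_phGain3_angular_le`, p496685).

Arithmetic over landed lemmas; nothing about the model is asserted.  0 kit.
-/

noncomputable section

namespace Summit.HubbardSuperconductivity.HubbardSuperconductivity.Theorems.KLRegimeSplit

set_option linter.dupNamespace false -- summit = problem name (single-conjunct summit), D-0017

open Finset Literature.MathematicalPhysics.QuantumLattice Literature.Probability.LatticeModels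
open Summit.HubbardSuperconductivity.HubbardSuperconductivity.Theorems.KLProgrammeLegKernels

/-- `klEngGeo5.phGain = 2^28 · klEngGeo3.phGain` (Geo4's gains are Geo3's). -/
theorem klEngGeo5_phGain_eq_mul_geo3 (n : ℕ) (ρ : ℝ) :
    EngineV8.klEngGeo5.phGain n ρ = 2 ^ 28 * EngineV8.klEngGeo3.phGain n ρ := by
  rw [EngineV8.klEngGeo5_phGain_eq, EngineV8.klEngGeo4_phGain]

/-- `klEngGeo5.ppGain = 2^28 · klEngGeo3.ppGain`. -/
theorem klEngGeo5_ppGain_eq_mul_geo3 (n : ℕ) (ρ : ℝ) :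
    EngineV8.klEngGeo5.ppGain n ρ = 2 ^ 28 * EngineV8.klEngGeo3.ppGain n ρ := by
  rw [EngineV8.klEngGeo5_ppGain_eq, EngineV8.klEngGeo4_ppGain]

/-- **`klEngGeo5.phGain (n − 1) ρ ≤ 4 · klEngGeo5.phGain n ρ`** — reading a crossed gain one scale down costs a factor `4` (Geo5 twin of
`klEngGeo3_phGain_pred_le`). -/
theorem klEngGeo5_phGain_pred_le (n : ℕ) (ρ : ℝ) : EngineV8.klEngGeo5.phGain (n - 1) ρ ≤ 4 * EngineV8.klEngGeo5.phGain n ρ := by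
  rw [klEngGeo5_phGain_eq_mul_geo3, klEngGeo5_phGain_eq_mul_geo3]
  have h := klEngGeo3_phGain_pred_le n ρ
  nlinarith

variable {L : ℕ} [NeZero L]

/-- **The angular mass number at Geo5**: for a nonnegative distribution `ρ` on the torus with total mass `≤ Z` and
`Σ_{|p − c₀|_𝕋 ≤ η} ρ_p ≤ A·η` for every `η ≥ 4^{−n}`,
`Σ_p ρ_p·klEngGeo5.phGain n |p − c₀|_𝕋 ≤ 2^28·(2^24·klE0·4^{−n}·A·(1 + 4n) + Z·4^{−n} + 2^24·√klE0·2^{−n}·Z)` (Geo5 twin of `klam_phGain3_angular_le`). -/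
theorem klam_phGain5_angular_le (ρ : TorusSite 2 L → ℝ) (c₀ : TorusSite 2 L) (n : ℕ) {A Z : ℝ} (hρ : ∀ p, 0 ≤ ρ p)
    (hmass : ∀ η : ℝ, ((4 : ℝ) ^ n)⁻¹ ≤ η → ∑ p ∈ univ.filter (fun p => klTorusNorm L (p - c₀) ≤ η), ρ p ≤ A * η)
    (hZ : ∑ p, ρ p ≤ Z) :
    ∑ p, ρ p * EngineV8.klEngGeo5.phGain n (klTorusNorm L (p - c₀)) ≤
      (2 : ℝ) ^ 28 * ((2 : ℝ) ^ 24 * klE0 * ((4 : ℝ) ^ n)⁻¹ * A * (1 + 4 * n) + Z * ((4 : ℝ) ^ n)⁻¹ +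
        2 ^ 24 * Real.sqrt klE0 * ((2 : ℝ) ^ n)⁻¹ * Z) := by
  have h := klam_phGain3_angular_le (L := L) ρ c₀ n hρ hmass hZ
  have hrw : ∑ p, ρ p * EngineV8.klEngGeo5.phGain n (klTorusNorm L (p - c₀)) =
      2 ^ 28 * ∑ p, ρ p * EngineV8.klEngGeo3.phGain n (klTorusNorm L (p - c₀)) := by
    rw [mul_sum]
    refine sum_congr rfl fun p _ => ?_
    rw [klEngGeo5_phGain_eq_mul_geo3]
    ring
  rw [hrw]
  exact mul_le_mul_of_nonneg_left h (by norm_num)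

end Summit.HubbardSuperconductivity.HubbardSuperconductivity.Theorems.KLRegimeSplit

end
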